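import Mathlib.Analysis.Convex.SpecificFunctions.Deriv
import Mathlib.Analysis.SpecialFunctions.Trigonometric.Basic
import Mathlib.Analysis.Calculus.Deriv.MeanValue
import Literature.MathematicalPhysics.QuantumLattice.HubbardFreePropagator
import HarnessLib

/-!
# Level counting on the square-lattice torus: thin shells around a Fermi curve away from `μ ∈ {0, ±4}`

Topic `MathematicalPhysics/QuantumLattice`. For the free band `ε_L(k) = -2cos(2πk₁/L) - 2cos(2πk₂/L)`
of the `L × L` torus (`torusBand`) and a chemical potential `μ` at distance `≥ d₀ > 0` from the
three critical values `{-4, 0, 4}` (band edges and the van Hove energy), we PROVE the uniform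
density-of-states bound

  `#{k ∈ (ℤ/Lℤ)² : |ε_L(k) - μ| < η} ≤ 4L(ηL/(2π√(d₀/8)) + 1)`   for `0 < η ≤ d₀/2`

(`card_torusShell_le`) — the finite-volume form of "the `d = 2` density of states is bounded away
from the band edges and the van Hove point"; its consequence for the Fermi-surface weights
`Σ_k β/(2 + β|ε_L(k) - μ|) ≲ (1 + log β)L² + βL` (the torus Cooper logarithm; Salmhofer,
*Renormalization* (1999) §4.5.4) is `TorusFermiWeightSum.lean`.

## Method (no measure theory)

On the shell `|ε - μ| < η ≤ d₀/2` the gradient is bounded below: `max(|sin θ₁|, |sin θ₂|) ≥ √(d₀/8)`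
(`abs_sin_ge_of_mem_shell`: if both sines are small, both cosines are within `d₀/8` of `±1` and
`ε` is within `d₀/2` of `{-4, 0, 4}`). On a row `θ₂ = const` with `σ sin θ₁ ≥ s₀ > 0`
(`σ = ±1`), `θ₁ ↦ cos θ₁` is bi-Lipschitz from below with constant `s₀` (mean value inequality and
concavity of `sin` on `[0, π]`, `mul_abs_sub_le_abs_cos_sub_cos`), so the grid points of the row in
the shell have indices in a real interval of length `< ηL/(2πs₀)`, hence number `≤ ηL/(2πs₀) + 1`
(`card_row_le`); summing over rows, signs and the two coordinate directions gives the count.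

Everything is proved; no definition and no named fact.
-/

noncomputable section

namespace Literature.MathematicalPhysics.QuantumLattice

open Real Set Finset Literature.Probability.LatticeModels

/-! ### Calculus: `cos` is bi-Lipschitz from below where `|sin| ≥ s₀` -/

/-- On `[0, π]`, if `sin θ, sin θ' ≥ s₀` then `s₀ |θ - θ'| ≤ |cos θ - cos θ'|` (`sin ≥ s₀` on the
whole segment by concavity of `sin` on `[0,π]`, then the mean value inequality for `-cos`). [folklore] -/
theorem mul_abs_sub_le_abs_cos_sub_cos {s₀ θ θ' : ℝ} (hθ : θ ∈ Icc 0 π) (hθ' : θ' ∈ Icc 0 π)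
    (hs : s₀ ≤ Real.sin θ) (hs' : s₀ ≤ Real.sin θ') : s₀ * |θ - θ'| ≤ |Real.cos θ - Real.cos θ'| := by
  -- the one-sided statement for `x ≤ y`
  have key : ∀ x y : ℝ, x ∈ Icc 0 π → y ∈ Icc 0 π → s₀ ≤ Real.sin x → s₀ ≤ Real.sin y → x ≤ y →
      s₀ * (y - x) ≤ Real.cos x - Real.cos y := by
    intro x y hx hy hsx hsy hxy
    have hseg : ∀ z ∈ Icc x y, s₀ ≤ Real.sin z := fun z hz =>
      (le_min hsx hsy).trans (strictConcaveOn_sin_Icc.concaveOn.min_le_of_mem_Icc hx hy hz)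
    have hd : ∀ t : ℝ, HasDerivAt (fun t => -Real.cos t) (Real.sin t) t := fun t => by
      have h := (Real.hasDerivAt_cos t).neg
      rw [neg_neg] at h
      exact h
    have hmv := Convex.mul_sub_le_image_sub_of_le_deriv (convex_Icc x y) (f := fun t => -Real.cos t)
      (Real.continuous_cos.neg.continuousOn) (fun t _ => (hd t).differentiableAt.differentiableWithinAt)
      (C := s₀) (fun t ht => by
        rw [(hd t).deriv]
        exact hseg t (interior_subset ht)) x (left_mem_Icc.2 hxy) y (right_mem_Icc.2 hxy) hxy
    linarith
  rcases le_total θ θ' with h | h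
  · rw [abs_sub_comm θ θ', abs_of_nonneg (sub_nonneg.2 h)]
    exact (key θ θ' hθ hθ' hs hs' h).trans (le_abs_self _)
  · rw [abs_of_nonneg (sub_nonneg.2 h), abs_sub_comm]
    exact (key θ' θ hθ' hθ hs' hs h).trans (le_abs_self _)

/-- The same on `[0, 2π]` for two angles whose sines are both `≥ s₀` or both `≤ -s₀` (`s₀ > 0`):
`s₀ |θ - θ'| ≤ |cos θ - cos θ'|` (the second case by the reflection `θ ↦ 2π - θ`). [folklore] -/
theorem mul_abs_sub_le_abs_cos_sub_cos' {s₀ θ θ' : ℝ} (hs₀ : 0 < s₀) (hθ : θ ∈ Icc 0 (2 * π))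
    (hθ' : θ' ∈ Icc 0 (2 * π))
    (h : (s₀ ≤ Real.sin θ ∧ s₀ ≤ Real.sin θ') ∨ (Real.sin θ ≤ -s₀ ∧ Real.sin θ' ≤ -s₀)) :
    s₀ * |θ - θ'| ≤ |Real.cos θ - Real.cos θ'| := by
  -- an angle in `[0, 2π]` with positive sine lies in `[0, π]`
  have up : ∀ x : ℝ, x ∈ Icc 0 (2 * π) → 0 < Real.sin x → x ∈ Icc 0 π := by
    intro x hx hpos
    refine ⟨hx.1, le_of_not_gt fun hπ => ?_⟩
    have h1 : 0 ≤ Real.sin (x - π) := Real.sin_nonneg_of_nonneg_of_le_pi (by linarith) (by linarith [hx.2])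
    have h2 : Real.sin (x - π) = -Real.sin x := Real.sin_sub_pi x
    linarith
  rcases h with ⟨h1, h2⟩ | ⟨h1, h2⟩
  · exact mul_abs_sub_le_abs_cos_sub_cos (up θ hθ (hs₀.trans_le h1)) (up θ' hθ' (hs₀.trans_le h2)) h1 h2
  · -- reflect
    have hr : ∀ x : ℝ, x ∈ Icc 0 (2 * π) → Real.sin x ≤ -s₀ → (2 * π - x) ∈ Icc 0 π ∧ s₀ ≤ Real.sin (2 * π - x) := by
      intro x hx hsx
      have hpos : 0 < Real.sin (2 * π - x) := by rw [Real.sin_two_pi_sub]; linarith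
      exact ⟨up _ ⟨by linarith [hx.2], by linarith [hx.1]⟩ hpos, by rw [Real.sin_two_pi_sub]; linarith⟩
    obtain ⟨hθr, hsr⟩ := hr θ hθ h1
    obtain ⟨hθr', hsr'⟩ := hr θ' hθ' h2
    have := mul_abs_sub_le_abs_cos_sub_cos hθr hθr' hsr hsr'
    rwa [Real.cos_two_pi_sub, Real.cos_two_pi_sub, show 2 * π - θ - (2 * π - θ') = -(θ - θ') by ring,
      abs_neg] at this

/-! ### Combinatorics: a set of naturals of small diameter is small -/

/-- A finite set of naturals all of whose (real) differences are `< D` has at most `D + 1` elements.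
[folklore] -/
theorem card_le_of_forall_sub_lt {S : Finset ℕ} {D : ℝ} (hD : 0 ≤ D)
    (h : ∀ a ∈ S, ∀ b ∈ S, ((b : ℝ) - a) < D) : (S.card : ℝ) ≤ D + 1 := by
  rcases S.eq_empty_or_nonempty with rfl | hne
  · simp; linarith
  · set m := S.min' hne with hm
    have hsub : S ⊆ Finset.Ico m (m + ⌈D⌉₊) := by
      intro b hb
      rw [Finset.mem_Ico]
      refine ⟨Finset.min'_le S b hb, ?_⟩
      have h1 := h m (Finset.min'_mem S hne) b hb
      have h2 : ((b : ℕ) : ℝ) < m + ⌈D⌉₊ := by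
        have := Nat.le_ceil D
        linarith
      exact_mod_cast h2
    have hcard := Finset.card_le_card hsub
    rw [Nat.card_Ico, add_tsub_cancel_left] at hcard
    calc (S.card : ℝ) ≤ ⌈D⌉₊ := by exact_mod_cast hcard
      _ ≤ D + 1 := (Nat.ceil_lt_add_one hD).le

/-! ### One row of the torus -/

variable {L : ℕ} [NeZero L]

/-- The angle `2π a/L` of `a ∈ ℤ/Lℤ` lies in `[0, 2π]`. [folklore] -/
theorem angle_mem_Icc (a : ZMod L) : 2 * π * (a.val : ℝ) / L ∈ Icc 0 (2 * π) := by
  have hL : (0 : ℝ) < L := by exact_mod_cast Nat.pos_of_ne_zero (NeZero.ne L)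
  have ha : (a.val : ℝ) < L := by exact_mod_cast ZMod.val_lt a
  constructor
  · positivity
  · rw [div_le_iff₀ hL]
    nlinarith [Real.pi_pos]

/-- **Row count.** For `s₀ > 0`, `η ≥ 0`, a real offset `c` and a sign condition, the residues
`a ∈ ℤ/Lℤ` with `σ·sin(2πa/L) ≥ s₀` (all of the same sign `σ`) and `|2cos(2πa/L) + c| < η` are at
most `ηL/(2πs₀) + 1` in number: their angles are pairwise closer than `η/s₀`. [folklore] -/
theorem card_row_le {s₀ η : ℝ} (hs₀ : 0 < s₀) (hη : 0 ≤ η) (c : ℝ) (pos : Bool) :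
    ((Finset.univ.filter fun a : ZMod L =>
        (if pos then s₀ ≤ Real.sin (2 * π * (a.val : ℝ) / L) else Real.sin (2 * π * (a.val : ℝ) / L) ≤ -s₀) ∧
          |2 * Real.cos (2 * π * (a.val : ℝ) / L) + c| < η).card : ℝ) ≤
      η * L / (2 * π * s₀) + 1 := by
  have hL : (0 : ℝ) < L := by exact_mod_cast Nat.pos_of_ne_zero (NeZero.ne L)
  set R := Finset.univ.filter fun a : ZMod L =>
        (if pos then s₀ ≤ Real.sin (2 * π * (a.val : ℝ) / L) else Real.sin (2 * π * (a.val : ℝ) / L) ≤ -s₀) ∧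
          |2 * Real.cos (2 * π * (a.val : ℝ) / L) + c| < η with hR
  -- pass to the set of representatives in `ℕ`
  have hinj : Set.InjOn (fun a : ZMod L => a.val) R := fun a _ b _ hab => ZMod.val_injective L hab
  rw [← Finset.card_image_of_injOn hinj]
  refine card_le_of_forall_sub_lt (by positivity) ?_
  intro x hx y hy
  rw [Finset.mem_image] at hx hy
  obtain ⟨a, ha, rfl⟩ := hx
  obtain ⟨b, hb, rfl⟩ := hy
  rw [hR, Finset.mem_filter] at ha hb
  -- the two angles
  set θa := 2 * π * (a.val : ℝ) / L with hθa
  set θb := 2 * π * (b.val : ℝ) / L with hθb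
  have hsign : (s₀ ≤ Real.sin θa ∧ s₀ ≤ Real.sin θb) ∨ (Real.sin θa ≤ -s₀ ∧ Real.sin θb ≤ -s₀) := by
    cases pos
    · right; exact ⟨by simpa using ha.2.1, by simpa using hb.2.1⟩
    · left; exact ⟨by simpa using ha.2.1, by simpa using hb.2.1⟩
  have hcore := mul_abs_sub_le_abs_cos_sub_cos' hs₀ (angle_mem_Icc a) (angle_mem_Icc b) hsign
  have hcos : |Real.cos θa - Real.cos θb| < η := by
    have h1 := ha.2.2
    have h2 := hb.2.2
    rw [abs_lt] at h1 h2 ⊢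
    constructor <;> linarith
  have hθ : |θa - θb| < η / s₀ := by
    rw [lt_div_iff₀ hs₀, mul_comm]
    exact hcore.trans_lt hcos
  have hdiff : θb - θa = 2 * π / L * ((b.val : ℝ) - a.val) := by
    rw [hθa, hθb]; field_simp
  have h2πL : 0 < 2 * π / L := by positivity
  calc ((b.val : ℝ) - a.val) = (θb - θa) / (2 * π / L) := by
        rw [hdiff]; field_simp
    _ ≤ |θa - θb| / (2 * π / L) := by
        gcongr
        rw [abs_sub_comm]; exact le_abs_self _
    _ < η / s₀ / (2 * π / L) := by gcongr
    _ = η * L / (2 * π * s₀) := by field_simp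

/-! ### The gradient bound on the shell -/

/-- If `|c| ≤ 1` and `c² > 1 - δ` then `|c| > 1 - δ`. [folklore] -/
theorem one_sub_lt_abs_of_sq {c δ : ℝ} (hc : |c| ≤ 1) (h : 1 - δ < c ^ 2) : 1 - δ < |c| := by
  have : c ^ 2 ≤ |c| := by
    rw [← sq_abs]
    nlinarith [abs_nonneg c]
  linarith

/-- **Gradient bound on the shell.** If `μ` is at distance `≥ d₀` from `-4` and from `0` (and `μ < 0`),
`0 < η ≤ d₀/2` and `|-2cos θ₀ - 2cos θ₁ - μ| < η`, then `|sin θ₀| ≥ √(d₀/8)` or `|sin θ₁| ≥ √(d₀/8)`: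
otherwise both cosines are within `d₀/8` of `±1` and `-2(cos θ₀ + cos θ₁)` is within `d₀/2` of
`{-4, 0, 4}`, contradicting `|μ + 4|, |μ| ≥ d₀`, `μ ≤ 0 < 4`. [folklore] -/
theorem abs_sin_ge_of_mem_shell {μ d₀ η θ₀ θ₁ : ℝ} (hμ4 : d₀ ≤ μ + 4) (hμ0 : d₀ ≤ -μ)
    (hηd : η ≤ d₀ / 2) (hshell : |-2 * Real.cos θ₀ - 2 * Real.cos θ₁ - μ| < η) :
    Real.sqrt (d₀ / 8) ≤ |Real.sin θ₀| ∨ Real.sqrt (d₀ / 8) ≤ |Real.sin θ₁| := by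
  by_contra hcon
  rw [not_or, not_le, not_le] at hcon
  obtain ⟨h0, h1⟩ := hcon
  have hd₀ : 0 < d₀ := by
    have := abs_nonneg (-2 * Real.cos θ₀ - 2 * Real.cos θ₁ - μ)
    linarith
  have hs : Real.sqrt (d₀ / 8) ^ 2 = d₀ / 8 := Real.sq_sqrt (by positivity)
  have hsin0 : Real.sin θ₀ ^ 2 < d₀ / 8 := by
    rw [← hs, ← sq_abs (Real.sin θ₀)]
    exact pow_lt_pow_left₀ h0 (abs_nonneg _) two_ne_zero
  have hsin1 : Real.sin θ₁ ^ 2 < d₀ / 8 := by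
    rw [← hs, ← sq_abs (Real.sin θ₁)]
    exact pow_lt_pow_left₀ h1 (abs_nonneg _) two_ne_zero
  have hcos0 : 1 - d₀ / 8 < |Real.cos θ₀| :=
    one_sub_lt_abs_of_sq (Real.abs_cos_le_one _) (by nlinarith [Real.sin_sq_add_cos_sq θ₀])
  have hcos1 : 1 - d₀ / 8 < |Real.cos θ₁| :=
    one_sub_lt_abs_of_sq (Real.abs_cos_le_one _) (by nlinarith [Real.sin_sq_add_cos_sq θ₁])
  have hc0 := Real.abs_cos_le_one θ₀
  have hc1 := Real.abs_cos_le_one θ₁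
  rw [abs_lt] at hshell
  -- four sign cases for the two cosines
  rcases abs_cases (Real.cos θ₀) with ⟨ha0, _⟩ | ⟨ha0, _⟩ <;>
    rcases abs_cases (Real.cos θ₁) with ⟨ha1, _⟩ | ⟨ha1, _⟩ <;>
    · rw [ha0] at hcos0 hc0
      rw [ha1] at hcos1 hc1
      nlinarith

/-! ### The shell count -/

omit [NeZero L] in
/-- `ε_L(k) = -2cos(2πk₀/L) - 2cos(2πk₁/L)` in coordinates. [folklore] -/
theorem torusBand_two_eq (k : TorusSite 2 L) :
    torusBand L k = -2 * Real.cos (2 * π * ((k 0).val : ℝ) / L) - 2 * Real.cos (2 * π * ((k 1).val : ℝ) / L) := by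
  rw [torusBand, Fin.sum_univ_two]
  simp only [latticeMomentum]
  ring

/-- Count of one direction and one sign: the `k` in the shell with `σ sin θ_i(k) ≥ s₀` number at most
`L (ηL/(2πs₀) + 1)` (fibre over the other coordinate, then `card_row_le`). [folklore] -/
theorem card_shell_dir_le {s₀ η : ℝ} (hs₀ : 0 < s₀) (hη : 0 ≤ η) (μ : ℝ) (i : Fin 2) (pos : Bool) :
    ((Finset.univ.filter fun k : TorusSite 2 L =>
        (if pos then s₀ ≤ Real.sin (2 * π * ((k i).val : ℝ) / L) else Real.sin (2 * π * ((k i).val : ℝ) / L) ≤ -s₀) ∧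
          |torusBand L k - μ| < η).card : ℝ) ≤ L * (η * L / (2 * π * s₀) + 1) := by
  -- the other coordinate
  set j : Fin 2 := if i = 0 then 1 else 0 with hj
  have hij : ∀ k : TorusSite 2 L, torusBand L k - μ =
      -(2 * Real.cos (2 * π * ((k i).val : ℝ) / L) + (2 * Real.cos (2 * π * ((k j).val : ℝ) / L) + μ)) := by
    intro k
    rw [torusBand_two_eq]
    fin_cases i <;> simp [hj] <;> ring
  set S := Finset.univ.filter fun k : TorusSite 2 L =>
        (if pos then s₀ ≤ Real.sin (2 * π * ((k i).val : ℝ) / L) else Real.sin (2 * π * ((k i).val : ℝ) / L) ≤ -s₀) ∧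
          |torusBand L k - μ| < η with hS
  -- fibre over the `j`-coordinate
  have hfib := Finset.card_eq_sum_card_fiberwise (f := fun k : TorusSite 2 L => k j) (s := S) (t := Finset.univ)
    (fun _ _ => Finset.mem_univ _)
  have hrow : ∀ r : ZMod L, (((S.filter fun k => k j = r)).card : ℝ) ≤ η * L / (2 * π * s₀) + 1 := by
    intro r
    refine le_trans ?_ (card_row_le (L := L) hs₀ hη (2 * Real.cos (2 * π * (r.val : ℝ) / L) + μ) pos)
    refine Nat.cast_le.2 (Finset.card_le_card_of_injOn (fun k => k i) ?_ ?_)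
    · intro k hk
      rw [Finset.mem_coe, Finset.mem_filter, hS, Finset.mem_filter] at hk
      obtain ⟨⟨_, hsign, hsh⟩, hkr⟩ := hk
      rw [Finset.mem_coe, Finset.mem_filter]
      refine ⟨Finset.mem_univ _, hsign, ?_⟩
      rw [hij k, abs_neg, hkr] at hsh
      exact hsh
    · intro k hk k' hk' hkk'
      rw [Finset.mem_coe, Finset.mem_filter] at hk hk'
      funext l
      fin_cases i <;> fin_cases l <;> simp_all
  calc (S.card : ℝ) = ∑ r : ZMod L, (((S.filter fun k => k j = r)).card : ℝ) := by
        rw [hfib]; push_cast; rfl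
    _ ≤ ∑ _r : ZMod L, (η * L / (2 * π * s₀) + 1) := Finset.sum_le_sum fun r _ => hrow r
    _ = L * (η * L / (2 * π * s₀) + 1) := by
        rw [Finset.sum_const, Finset.card_univ, ZMod.card, nsmul_eq_mul]

/-- **Level counting on the torus.** For `μ` with `μ + 4 ≥ d₀`, `-μ ≥ d₀` and `0 < η ≤ d₀/2`,
`#{k ∈ (ℤ/Lℤ)² : |ε_L(k) - μ| < η} ≤ 4L(ηL/(2π√(d₀/8)) + 1)` for every `L ≥ 1`. [folklore] -/
theorem card_torusShell_le {μ d₀ η : ℝ} (hμ4 : d₀ ≤ μ + 4) (hμ0 : d₀ ≤ -μ) (hη : 0 < η)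
    (hηd : η ≤ d₀ / 2) :
    ((Finset.univ.filter fun k : TorusSite 2 L => |torusBand L k - μ| < η).card : ℝ) ≤
      4 * (L * (η * L / (2 * π * Real.sqrt (d₀ / 8)) + 1)) := by
  have hd₀ : 0 < d₀ := by linarith
  set s₀ := Real.sqrt (d₀ / 8) with hs₀def
  have hs₀ : 0 < s₀ := Real.sqrt_pos.2 (by positivity)
  clear_value s₀
  -- the four pieces
  set P : Fin 2 → Bool → Finset (TorusSite 2 L) := fun i pos => Finset.univ.filter fun k : TorusSite 2 L =>
        (if pos then s₀ ≤ Real.sin (2 * π * ((k i).val : ℝ) / L) else Real.sin (2 * π * ((k i).val : ℝ) / L) ≤ -s₀) ∧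
          |torusBand L k - μ| < η with hP
  have hcover : (Finset.univ.filter fun k : TorusSite 2 L => |torusBand L k - μ| < η) ⊆
      (P 0 true ∪ P 0 false) ∪ (P 1 true ∪ P 1 false) := by
    intro k hk
    rw [Finset.mem_filter] at hk
    have hsh := hk.2
    have hgrad := abs_sin_ge_of_mem_shell (θ₀ := 2 * π * ((k 0).val : ℝ) / L)
      (θ₁ := 2 * π * ((k 1).val : ℝ) / L) hμ4 hμ0 hηd (by rw [← torusBand_two_eq]; exact hsh)
    rw [← hs₀def] at hgrad
    simp only [Finset.mem_union, hP, Finset.mem_filter, Finset.mem_univ, true_and]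
    rcases hgrad with h | h
    · left
      rcases le_abs'.1 h with h' | h'
      · right; exact ⟨by simpa using h', hsh⟩
      · left; exact ⟨by simpa using h', hsh⟩
    · right
      rcases le_abs'.1 h with h' | h'
      · right; exact ⟨by simpa using h', hsh⟩
      · left; exact ⟨by simpa using h', hsh⟩
  have hpiece : ∀ (i : Fin 2) (pos : Bool), ((P i pos).card : ℝ) ≤ L * (η * L / (2 * π * s₀) + 1) :=
    fun i pos => card_shell_dir_le hs₀ hη.le μ i pos
  calc ((Finset.univ.filter fun k : TorusSite 2 L => |torusBand L k - μ| < η).card : ℝ)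
      ≤ (((P 0 true ∪ P 0 false) ∪ (P 1 true ∪ P 1 false)).card : ℝ) := by
        exact_mod_cast Finset.card_le_card hcover
    _ ≤ ((P 0 true).card + (P 0 false).card) + ((P 1 true).card + (P 1 false).card) := by
        have h1 := Finset.card_union_le (P 0 true ∪ P 0 false) (P 1 true ∪ P 1 false)
        have h2 := Finset.card_union_le (P 0 true) (P 0 false)
        have h3 := Finset.card_union_le (P 1 true) (P 1 false)
        exact_mod_cast h1.trans (add_le_add h2 h3)
    _ ≤ 4 * (L * (η * L / (2 * π * s₀) + 1)) := by
        have := hpiece 0 true; have := hpiece 0 false; have := hpiece 1 true; have := hpiece 1 false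
        linarith

end Literature.MathematicalPhysics.QuantumLattice
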